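import Summits.Ventures.PercRepro.S1CFGTrianglesTwo
import Summits.Ventures.PercRepro.S1CFGFourCircuits
import Summits.Ventures.PercRepro.S1CFGSix

/-!
# PercRepro — THE SHARPENED SIMPLE CHAIN AT NULLITY `5` AND `6`, BY NUMBER (p1, gen 39; feeder of S2's row `p = 12`)

The low-rank set counts of a SIMPLE (no dependent pair) coloop-free matroid of nullity `ν` on `n` points, with the triangle
cap `c₃ ≤ C(ν + 1, 3) + 1` (S1CFGTriangles / S1CFGTrianglesTwo) and the `4`-circuit averaging cap `c₄ ≤ ⌊n·C(ν + 2, 4)/(n − 4)⌋`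
(S1CFGFourCircuits) pushed through the landed double counts — the N-side vectors of the regime `ν = 4` of the cells `(12, 9)`
and `(12, 10)` (`Q_k^s = #{X ⊆ E : |X| = k, rk X ≤ s}`, `c₄ = #{4-circuits}`):

| `(ν, n)` | `c₃` | `Q₄²` | `c₄` | `D₄` | `Q₅²` | `Q₅³` | `Q₅⁴` | `Q₆²` | `Q₆³` | `Q₆⁴` |
|---|---|---|---|---|---|---|---|---|---|---|
| (5, 12) | 21 | 15 | 52 | 241 | 6 | 168 | 588 | — | — | — |
| (5, 13) | 21 | 15 | 50 | 260 | 6 | 183 | 832 | — | — | — |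
| (6, 13) | 36 | 36 | 101 | 461 | 21 | 433 | 1083 | 7 | 244 | 1299 |
| (6, 14) | 36 | 36 | 98 | 494 | 21 | 467 | 1495 | 7 | 265 | 1697 |

(the landed S1CFGSimpleFiveValues / S1CFGSixValues: `(35, 26, 70, 385, 10, 272, —)` at `(5, 12)`, `(56, 56, 126, 742, 33, 705, —, 11, 402, 2392)`
at `(6, 14)`). `chain_five_twelve`, `chain_five_thirteen`, `chain_six_thirteen`, `chain_six_fourteen` — one conjunction each.
Nothing about any cell is claimed. Axioms: standard.
-/

open scoped Matroid

namespace PercRepro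

namespace S1CFG

open Set S1CF

variable {α : Type}

/-- `Q₅¹ = 0` without dependent pairs (a `5`-set of rank `≤ 1` contains a `4`-set of rank `≤ 1`). -/
theorem ncard_five_eRk_le_one_eq_zero_of_no_dep_pair (M : Matroid α) [M.Finite]
    (h0 : {P : Set α | P ⊆ M.E ∧ P.ncard = 2 ∧ M.Dep P}.ncard = 0) :
    {X : Set α | X ⊆ M.E ∧ X.ncard = 5 ∧ M.eRk X ≤ 1}.ncard = 0 := by
  have hEfin := M.ground_finite
  rw [Set.ncard_eq_zero (hEfin.finite_subsets.subset (fun X hX => hX.1)), Set.eq_empty_iff_forall_notMem]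
  rintro X ⟨hXE, hX5, hXr⟩
  have h4 := ncard_four_eRk_le_one_eq_zero_of_no_dep_pair M h0
  rw [Set.ncard_eq_zero (hEfin.finite_subsets.subset (fun X hX => hX.1)), Set.eq_empty_iff_forall_notMem] at h4
  have hXfin : X.Finite := hEfin.subset hXE
  obtain ⟨x, hx⟩ : X.Nonempty := by rw [← Set.ncard_pos hXfin, hX5]; norm_num
  exact h4 (X \ {x}) ⟨sdiff_subset.trans hXE, by rw [Set.ncard_sdiff_singleton_of_mem hx, hX5],
    (M.eRk_mono sdiff_subset).trans hXr⟩

/-- **The chain at `(ν, n) = (5, 12)`**: `c₃ ≤ 21`, `Q₄² ≤ 15`, `c₄ ≤ 52`, `D₄ ≤ 241`, `Q₅² ≤ 6`, `Q₅³ ≤ 168`, `Q₅⁴ ≤ 588`. -/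
theorem chain_five_twelve (M : Matroid α) [M.Finite] (hK : ∀ e, ¬ M.IsColoop e)
    (hd : M.E.encard = M.eRank + ((5 : ℕ) : ℕ∞))
    (h0 : {P : Set α | P ⊆ M.E ∧ P.ncard = 2 ∧ M.Dep P}.ncard = 0) (hn : M.E.ncard = 12) :
    {X : Set α | X ⊆ M.E ∧ X.ncard = 3 ∧ M.eRk X ≤ 2}.ncard ≤ 21 ∧
    {X : Set α | X ⊆ M.E ∧ X.ncard = 4 ∧ M.eRk X ≤ 2}.ncard ≤ 15 ∧
    {X : Set α | X ⊆ M.E ∧ X.ncard = 4 ∧ M.IsCircuit X}.ncard ≤ 52 ∧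
    {X : Set α | X ⊆ M.E ∧ X.ncard = 4 ∧ M.eRk X ≤ 3}.ncard ≤ 241 ∧
    {X : Set α | X ⊆ M.E ∧ X.ncard = 5 ∧ M.eRk X ≤ 2}.ncard ≤ 6 ∧
    {X : Set α | X ⊆ M.E ∧ X.ncard = 5 ∧ M.eRk X ≤ 3}.ncard ≤ 168 ∧
    {X : Set α | X ⊆ M.E ∧ X.ncard = 5 ∧ M.eRk X ≤ 4}.ncard ≤ 588 := by
  have hr : (M.eRk M.E).toNat = 7 := by
    have := ncard_ground_eq_eRk_toNat_add M hd
    omega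
  have h3 := triangles_le_twentyone_of_nullity_five M hd hK h0 (by omega)
  have h42 := four_mul_ncard_four_eRk_le_two_le_mul M hK hd h0 (by omega)
  have h4 := ncard_fourCircuits_le_div M hK hd (by omega)
  have h4' : {X : Set α | X ⊆ M.E ∧ X.ncard = 4 ∧ M.IsCircuit X}.ncard ≤ 52 := by
    rw [hn] at h4
    exact h4.trans (by decide)
  have hD4 := ncard_four_eRk_le_three_le_add M h0
  have h52 := five_mul_ncard_five_eRk_le_two_le_of_no_dep_pair M hK hd h0 (by omega)
  have h53 := five_mul_ncard_five_eRk_le_three_le M hK hd (by omega)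
  have h54 := five_mul_ncard_five_eRk_le_four_le_exact M hK hd (by omega)
  rw [hn] at hD4 h53 h54
  rw [show Nat.choose 12 4 = 495 by decide] at h54
  omega

/-- **The chain at `(ν, n) = (5, 13)`**: `c₃ ≤ 21`, `Q₄² ≤ 15`, `c₄ ≤ 50`, `D₄ ≤ 260`, `Q₅² ≤ 6`, `Q₅³ ≤ 183`, `Q₅⁴ ≤ 832`. -/
theorem chain_five_thirteen (M : Matroid α) [M.Finite] (hK : ∀ e, ¬ M.IsColoop e)
    (hd : M.E.encard = M.eRank + ((5 : ℕ) : ℕ∞))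
    (h0 : {P : Set α | P ⊆ M.E ∧ P.ncard = 2 ∧ M.Dep P}.ncard = 0) (hn : M.E.ncard = 13) :
    {X : Set α | X ⊆ M.E ∧ X.ncard = 3 ∧ M.eRk X ≤ 2}.ncard ≤ 21 ∧
    {X : Set α | X ⊆ M.E ∧ X.ncard = 4 ∧ M.eRk X ≤ 2}.ncard ≤ 15 ∧
    {X : Set α | X ⊆ M.E ∧ X.ncard = 4 ∧ M.IsCircuit X}.ncard ≤ 50 ∧
    {X : Set α | X ⊆ M.E ∧ X.ncard = 4 ∧ M.eRk X ≤ 3}.ncard ≤ 260 ∧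
    {X : Set α | X ⊆ M.E ∧ X.ncard = 5 ∧ M.eRk X ≤ 2}.ncard ≤ 6 ∧
    {X : Set α | X ⊆ M.E ∧ X.ncard = 5 ∧ M.eRk X ≤ 3}.ncard ≤ 183 ∧
    {X : Set α | X ⊆ M.E ∧ X.ncard = 5 ∧ M.eRk X ≤ 4}.ncard ≤ 832 := by
  have hr : (M.eRk M.E).toNat = 8 := by
    have := ncard_ground_eq_eRk_toNat_add M hd
    omega
  have h3 := triangles_le_twentyone_of_nullity_five M hd hK h0 (by omega)
  have h42 := four_mul_ncard_four_eRk_le_two_le_mul M hK hd h0 (by omega)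
  have h4 := ncard_fourCircuits_le_div M hK hd (by omega)
  have h4' : {X : Set α | X ⊆ M.E ∧ X.ncard = 4 ∧ M.IsCircuit X}.ncard ≤ 50 := by
    rw [hn] at h4
    exact h4.trans (by decide)
  have hD4 := ncard_four_eRk_le_three_le_add M h0
  have h52 := five_mul_ncard_five_eRk_le_two_le_of_no_dep_pair M hK hd h0 (by omega)
  have h53 := five_mul_ncard_five_eRk_le_three_le M hK hd (by omega)
  have h54 := five_mul_ncard_five_eRk_le_four_le_exact M hK hd (by omega)
  rw [hn] at hD4 h53 h54
  rw [show Nat.choose 13 4 = 715 by decide] at h54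
  omega

/-- **The chain at `(ν, n) = (6, 13)`**: `c₃ ≤ 36`, `Q₄² ≤ 36`, `c₄ ≤ 101`, `D₄ ≤ 461`, `Q₅² ≤ 21`, `Q₅³ ≤ 433`,
`Q₅⁴ ≤ 1083`, `Q₆² ≤ 7`, `Q₆³ ≤ 244`, `Q₆⁴ ≤ 1299`. -/
theorem chain_six_thirteen (M : Matroid α) [M.Finite] (hK : ∀ e, ¬ M.IsColoop e)
    (hd : M.E.encard = M.eRank + ((6 : ℕ) : ℕ∞))
    (h0 : {P : Set α | P ⊆ M.E ∧ P.ncard = 2 ∧ M.Dep P}.ncard = 0) (hn : M.E.ncard = 13) :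
    {X : Set α | X ⊆ M.E ∧ X.ncard = 3 ∧ M.eRk X ≤ 2}.ncard ≤ 36 ∧
    {X : Set α | X ⊆ M.E ∧ X.ncard = 4 ∧ M.eRk X ≤ 2}.ncard ≤ 36 ∧
    {X : Set α | X ⊆ M.E ∧ X.ncard = 4 ∧ M.IsCircuit X}.ncard ≤ 101 ∧
    {X : Set α | X ⊆ M.E ∧ X.ncard = 4 ∧ M.eRk X ≤ 3}.ncard ≤ 461 ∧
    {X : Set α | X ⊆ M.E ∧ X.ncard = 5 ∧ M.eRk X ≤ 2}.ncard ≤ 21 ∧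
    {X : Set α | X ⊆ M.E ∧ X.ncard = 5 ∧ M.eRk X ≤ 3}.ncard ≤ 433 ∧
    {X : Set α | X ⊆ M.E ∧ X.ncard = 5 ∧ M.eRk X ≤ 4}.ncard ≤ 1083 ∧
    {X : Set α | X ⊆ M.E ∧ X.ncard = 6 ∧ M.eRk X ≤ 2}.ncard ≤ 7 ∧
    {X : Set α | X ⊆ M.E ∧ X.ncard = 6 ∧ M.eRk X ≤ 3}.ncard ≤ 244 ∧
    {X : Set α | X ⊆ M.E ∧ X.ncard = 6 ∧ M.eRk X ≤ 4}.ncard ≤ 1299 := by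
  have hr : (M.eRk M.E).toNat = 7 := by
    have := ncard_ground_eq_eRk_toNat_add M hd
    omega
  have h3 := triangles_le_thirtysix_of_nullity_six' M hd hK h0 (by omega)
  have h42 := four_mul_ncard_four_eRk_le_two_le_mul M hK hd h0 (by omega)
  have h4 := ncard_fourCircuits_le_div M hK hd (by omega)
  have h4' : {X : Set α | X ⊆ M.E ∧ X.ncard = 4 ∧ M.IsCircuit X}.ncard ≤ 101 := by
    rw [hn] at h4
    exact h4.trans (by decide)
  have hD4 := ncard_four_eRk_le_three_le_add M h0
  have h52 := five_mul_ncard_five_eRk_le_two_le_of_no_dep_pair M hK hd h0 (by omega)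
  have h53 := five_mul_ncard_five_eRk_le_three_le M hK hd (by omega)
  have h54 := five_mul_ncard_five_eRk_le_four_le_exact M hK hd (by omega)
  have h51 := ncard_five_eRk_le_one_eq_zero_of_no_dep_pair M h0
  have h62 := six_mul_ncard_six_eRk_le_two_le M hK hd (by omega)
  have h63 := six_mul_ncard_six_eRk_le_three_le M hK hd (by omega)
  have h64 := six_mul_ncard_six_eRk_le_four_le M hK hd (by omega)
  rw [hn] at hD4 h53 h54 h62 h63 h64
  rw [show Nat.choose 13 4 = 715 by decide] at h54
  rw [h51] at h62
  omega

/-- **The chain at `(ν, n) = (6, 14)`**: `c₃ ≤ 36`, `Q₄² ≤ 36`, `c₄ ≤ 98`, `D₄ ≤ 494`, `Q₅² ≤ 21`, `Q₅³ ≤ 467`,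
`Q₅⁴ ≤ 1495`, `Q₆² ≤ 7`, `Q₆³ ≤ 265`, `Q₆⁴ ≤ 1697`. -/
theorem chain_six_fourteen (M : Matroid α) [M.Finite] (hK : ∀ e, ¬ M.IsColoop e)
    (hd : M.E.encard = M.eRank + ((6 : ℕ) : ℕ∞))
    (h0 : {P : Set α | P ⊆ M.E ∧ P.ncard = 2 ∧ M.Dep P}.ncard = 0) (hn : M.E.ncard = 14) :
    {X : Set α | X ⊆ M.E ∧ X.ncard = 3 ∧ M.eRk X ≤ 2}.ncard ≤ 36 ∧
    {X : Set α | X ⊆ M.E ∧ X.ncard = 4 ∧ M.eRk X ≤ 2}.ncard ≤ 36 ∧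
    {X : Set α | X ⊆ M.E ∧ X.ncard = 4 ∧ M.IsCircuit X}.ncard ≤ 98 ∧
    {X : Set α | X ⊆ M.E ∧ X.ncard = 4 ∧ M.eRk X ≤ 3}.ncard ≤ 494 ∧
    {X : Set α | X ⊆ M.E ∧ X.ncard = 5 ∧ M.eRk X ≤ 2}.ncard ≤ 21 ∧
    {X : Set α | X ⊆ M.E ∧ X.ncard = 5 ∧ M.eRk X ≤ 3}.ncard ≤ 467 ∧
    {X : Set α | X ⊆ M.E ∧ X.ncard = 5 ∧ M.eRk X ≤ 4}.ncard ≤ 1495 ∧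
    {X : Set α | X ⊆ M.E ∧ X.ncard = 6 ∧ M.eRk X ≤ 2}.ncard ≤ 7 ∧
    {X : Set α | X ⊆ M.E ∧ X.ncard = 6 ∧ M.eRk X ≤ 3}.ncard ≤ 265 ∧
    {X : Set α | X ⊆ M.E ∧ X.ncard = 6 ∧ M.eRk X ≤ 4}.ncard ≤ 1697 := by
  have hr : (M.eRk M.E).toNat = 8 := by
    have := ncard_ground_eq_eRk_toNat_add M hd
    omega
  have h3 := triangles_le_thirtysix_of_nullity_six' M hd hK h0 (by omega)
  have h42 := four_mul_ncard_four_eRk_le_two_le_mul M hK hd h0 (by omega)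
  have h4 := ncard_fourCircuits_le_div M hK hd (by omega)
  have h4' : {X : Set α | X ⊆ M.E ∧ X.ncard = 4 ∧ M.IsCircuit X}.ncard ≤ 98 := by
    rw [hn] at h4
    exact h4.trans (by decide)
  have hD4 := ncard_four_eRk_le_three_le_add M h0
  have h52 := five_mul_ncard_five_eRk_le_two_le_of_no_dep_pair M hK hd h0 (by omega)
  have h53 := five_mul_ncard_five_eRk_le_three_le M hK hd (by omega)
  have h54 := five_mul_ncard_five_eRk_le_four_le_exact M hK hd (by omega)
  have h51 := ncard_five_eRk_le_one_eq_zero_of_no_dep_pair M h0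
  have h62 := six_mul_ncard_six_eRk_le_two_le M hK hd (by omega)
  have h63 := six_mul_ncard_six_eRk_le_three_le M hK hd (by omega)
  have h64 := six_mul_ncard_six_eRk_le_four_le M hK hd (by omega)
  rw [hn] at hD4 h53 h54 h62 h63 h64
  rw [show Nat.choose 14 4 = 1001 by decide] at h54
  rw [h51] at h62
  omega

end S1CFG

end PercRepro
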